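import Literature.ModelTheory.ExponentialFields.DefinableBaire
import Literature.ModelTheory.ExponentialFields.DefinableCompletenessCodes
import HarnessLib

/-!
# The Baire scheme is a recursive set of sentences

Topic `Literature/ModelTheory/ExponentialFields`.  Fornasiero–Servi, *Definably complete Baire
structures*, Fund. Math. 209 (2010), Remark 2.10: "The fact that `K` is Baire can be expressed
by a set of first-order sentences … If moreover the language is recursive, this set of sentences
is also recursive."  This file proves the recursiveness for the scheme `DefinableBaire.scheme`
of `DefinableBaire.lean`, for Mathlib's concrete Gödel numbering and the tree's notion
`Theory.IsRecursive`, along the lines of `DefinableCompletenessCodes.lean` (the `[DC]` half):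

* `swapVar`, `swapTermCode`, `swapLetter`, `termLetters_swap`, **`formulaLetters_swapAt`** —
  the letters of `swapAt m φ` (the variable letters `4 m + 2`, `4 (m + 1) + 2` are exchanged
  inside the term codes), continuing `ProofTheory/LiftAtCodes.lean`;
* letter builders `notLetters`, `infLetters`, `ltLetters`, `covLetters`, `incLetters`,
  `clLetters`, `ndLetters`, `baireLetters` and **`formulaLetters_sentence`**: the letters of the
  instance `sentence φ` as an explicit primitive recursive function of `m` and the letters of
  `φ`;
* the recogniser `baireLettersB` (the letters of `φ` are read off after the prefix by the
  recursive-descent recogniser `parseF` of `ProofTheory/SentenceCodes.lean`), its correctness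
  `baireLettersB_iff`, `primrec_baireLettersB`, `computable_baireLettersB`;
* **`DefinableBaire.isRecursive_scheme`** (every language with computable arity tables),
  `isRecursive_scheme_orderedExpRing` (the language of `ℝ_exp`), `isRecursive_scheme_orderedRing`.

Everything is proved; no named facts.

## References

* A. Fornasiero, T. Servi, *Definably complete Baire structures*, Fund. Math. 209 (2010),
  Remark 2.10. [FornasieroServi2010]
* H. B. Enderton, *A Mathematical Introduction to Logic*, 2nd ed. (2001), §3.4. [Enderton2001]
-/

open FirstOrder FirstOrder.Language Encodable Denumerable
open Literature.ModelTheory.ProofTheory.PreFOL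

namespace Literature.ModelTheory.ExponentialFields

namespace DefinableBaire

/-! ### Exchanging two variables on letters -/

/-- On a term letter: the variable letters `4 m + 2` and `4 (m + 1) + 2` are exchanged; all
other letters are unchanged. [folklore] -/
def swapVar (m x : ℕ) : ℕ :=
  if x % 4 = 2 ∧ x / 4 = m then x + 4 else if x % 4 = 2 ∧ x / 4 = m + 1 then x - 4 else x

/-- On a term code: decode the letters, exchange the two variables, encode. [folklore] -/
def swapTermCode (m c : ℕ) : ℕ := encode ((ofNat (List ℕ) c).map (swapVar m))

/-- On a formula letter: the term letters `2 ⟨k, c⟩` (the even ones) have their term code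
transformed; all other letters are unchanged. [folklore] -/
def swapLetter (m x : ℕ) : ℕ :=
  if x % 2 = 0 then 2 * Nat.pair (x / 2).unpair.1 (swapTermCode m (x / 2).unpair.2) else x

/-- Odd letters are unchanged by `swapLetter`. [folklore] -/
theorem swapLetter_of_odd (m : ℕ) {x : ℕ} (h : x % 2 = 1) : swapLetter m x = x := by
  unfold swapLetter; rw [if_neg]; omega

/-- `swapLetter` on a term letter. [folklore] -/
theorem swapLetter_termLetter (m k c : ℕ) :
    swapLetter m (2 * Nat.pair k c) = 2 * Nat.pair k (swapTermCode m c) := by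
  unfold swapLetter
  rw [if_pos (by omega), Nat.mul_div_cancel_left _ (by norm_num), Nat.unpair_pair]

section Letters

variable {L : Language} [Encodable (Σ i, L.Functions i)] [Encodable (Σ i, L.Relations i)]

omit [Encodable (Σ i, L.Relations i)] in
/-- Letters of a term with two variables exchanged. [folklore] -/
theorem termLetters_swap {k m : ℕ} (h : m + 1 < k) (t : L.Term (Empty ⊕ Fin k)) :
    termLetters (t.relabel (Sum.map id (swapFin m k))) = (termLetters t).map (swapVar m) := by
  induction t with
  | var a =>
    rcases a with e | i
    · exact e.elim
    · simp only [Term.relabel, Sum.map_inr, termLetters_var, List.map_cons, List.map_nil,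
        List.cons.injEq, and_true]
      rw [swapFin_val h]
      unfold swapVar
      have h1 : (4 * i.val + 2) % 4 = 2 := by omega
      have h2 : (4 * i.val + 2) / 4 = i.val := by omega
      by_cases hm : i.val = m
      · rw [if_pos hm, if_pos ⟨h1, by omega⟩]; omega
      · by_cases hm' : i.val = m + 1
        · rw [if_neg hm, if_pos hm', if_neg (by omega), if_pos ⟨h1, by omega⟩]; omega
        · rw [if_neg hm, if_neg hm', if_neg (by omega), if_neg (by omega)]
  | func F ts ih =>
    simp only [Term.relabel, termLetters_func, List.map_cons]
    have hodd : swapVar m (2 * encode (⟨_, F⟩ : Σ i, L.Functions i) + 1) =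
        2 * encode (⟨_, F⟩ : Σ i, L.Functions i) + 1 := by
      unfold swapVar; rw [if_neg (by omega), if_neg (by omega)]
    rw [hodd, List.map_flatten, List.map_ofFn]
    congr 2
    exact congrArg List.ofFn (funext fun i => by simpa using ih i)

omit [Encodable (Σ i, L.Relations i)] in
/-- The code of a term with two variables exchanged. [folklore] -/
theorem encode_swap {k m : ℕ} (h : m + 1 < k) (t : L.Term (Empty ⊕ Fin k)) :
    encode (t.relabel (Sum.map id (swapFin m k))) = swapTermCode m (encode t) := by
  rw [swapTermCode, ofNat_encode_term, ← termLetters_swap h, encode_term_eq]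

/-- **Letters of `swapAt m φ`**: obtained from the letters of `φ` letter by letter
(`swapLetter`), for `φ` of depth above `m + 1`. [folklore] -/
theorem formulaLetters_swapAt {k m : ℕ} (h : m + 1 < k) (φ : L.BoundedFormula Empty k) :
    formulaLetters (swapAt L m φ) = (formulaLetters φ).map (swapLetter m) := by
  induction φ with
  | falsum =>
    simp only [swapAt_falsum, formulaLetters_falsum, List.map_cons, List.map_nil]
    rw [swapLetter_of_odd m (by omega)]
  | equal t₁ t₂ =>
    simp only [swapAt_equal, formulaLetters_equal, encode_swap h, List.map_cons, List.map_nil,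
      swapLetter_termLetter]
  | @rel k a R ts =>
    simp only [swapAt_rel, formulaLetters_rel, encode_swap h, List.map_cons, List.map_ofFn]
    refine congrArg₂ _ (swapLetter_of_odd m (by omega)).symm
      (congrArg₂ _ (swapLetter_of_odd m (by omega)).symm ?_)
    exact congrArg List.ofFn (funext fun i => by simp [swapLetter_termLetter])
  | imp φ ψ ihφ ihψ =>
    simp only [swapAt_imp, formulaLetters_imp, List.map_cons, List.map_append, ihφ h, ihψ h]
    rw [swapLetter_of_odd m (by decide)]
  | all φ ih =>
    simp only [swapAt_all, formulaLetters_all, List.map_cons, ih (Nat.lt_succ_of_lt h)]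
    rw [swapLetter_of_odd m (by decide)]

end Letters

/-! ### Letter builders for the derived connectives and the instances of the scheme -/

/-- Letters of `∼θ` at depth `k` from the letters `w` of `θ`. [folklore] -/
def notLetters (k : ℕ) (w : List ℕ) : List ℕ := 3 :: (w ++ [4 * k + 11])

/-- Letters of `θ₁ ⊓ θ₂` at depth `k`. [folklore] -/
def infLetters (k : ℕ) (w₁ w₂ : List ℕ) : List ℕ :=
  3 :: ((3 :: (w₁ ++ 3 :: (w₂ ++ [4 * k + 11]))) ++ [4 * k + 11])

/-- Letters of `&i₁ < &i₂` at depth `k` (code `rLe` of `≤`). [folklore] -/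
def ltLetters (rLe k i₁ i₂ : ℕ) : List ℕ :=
  infLetters k (leLetters rLe k i₁ i₂) (notLetters k (leLetters rLe k i₂ i₁))

/-- Letters of `cov φ` from `m` and the letters `w` of `φ`. [folklore] -/
def covLetters (m : ℕ) (w : List ℕ) : List ℕ := 7 :: exLetters (m + 1) w

/-- Letters of `inc φ`. [folklore] -/
def incLetters (rLe m : ℕ) (w : List ℕ) : List ℕ :=
  7 :: 7 :: 7 :: 3 :: (leLetters rLe (m + 3) (m + 1) (m + 2) ++
    3 :: (liftLetters 1 (m + 2) w ++ liftLetters 1 (m + 1) w))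

/-- Letters of `clAnte m`. [folklore] -/
def clAnteLetters (rLe m : ℕ) : List ℕ :=
  infLetters (m + 4) (ltLetters rLe (m + 4) (m + 2) (m + 1)) (ltLetters rLe (m + 4) (m + 1) (m + 3))

/-- Letters of `lift3 ψ`. [folklore] -/
def lift3Letters (m : ℕ) (w : List ℕ) : List ℕ :=
  liftLetters 1 (m + 1) (liftLetters 1 (m + 1) (liftLetters 1 (m + 1) w))

/-- Letters of `clBody ψ`. [folklore] -/
def clBodyLetters (rLe m : ℕ) (w : List ℕ) : List ℕ :=
  infLetters (m + 5)
    (infLetters (m + 5) (ltLetters rLe (m + 5) (m + 2) (m + 4)) (ltLetters rLe (m + 5) (m + 4) (m + 3)))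
    (lift3Letters m w)

/-- Letters of `cl ψ`. [folklore] -/
def clLetters (rLe m : ℕ) (w : List ℕ) : List ℕ :=
  7 :: 7 :: 3 :: (clAnteLetters rLe m ++ exLetters (m + 4) (clBodyLetters rLe m w))

/-- Letters of `ndAnte m`. [folklore] -/
def ndAnteLetters (rLe m : ℕ) : List ℕ := ltLetters rLe (m + 3) (m + 1) (m + 2)

/-- Letters of `lift2 χ`. [folklore] -/
def lift2Letters (m : ℕ) (w : List ℕ) : List ℕ :=
  liftLetters 1 (m + 1) (liftLetters 1 (m + 1) w)

/-- Letters of `ndBody ψ`. [folklore] -/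
def ndBodyLetters (rLe m : ℕ) (w : List ℕ) : List ℕ :=
  infLetters (m + 4)
    (infLetters (m + 4) (ltLetters rLe (m + 4) (m + 1) (m + 3)) (ltLetters rLe (m + 4) (m + 3) (m + 2)))
    (notLetters (m + 4) (lift2Letters m (clLetters rLe m w)))

/-- Letters of `nd ψ`. [folklore] -/
def ndLetters (rLe m : ℕ) (w : List ℕ) : List ℕ :=
  7 :: 7 :: 7 :: 3 :: (ndAnteLetters rLe m ++ exLetters (m + 3) (ndBodyLetters rLe m w))

/-- **Letters of the instance `sentence φ`** from `m` and the letters `w` of `φ`. [folklore] -/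
def baireLetters (rLe m : ℕ) (w : List ℕ) : List ℕ :=
  List.replicate m 7 ++ 3 :: (covLetters m w ++ 3 :: (incLetters rLe m w ++
    notLetters m (ndLetters rLe m (w.map (swapLetter m)))))

section SchemeLetters

variable {L : Language} [Encodable (Σ i, L.Functions i)] [Encodable (Σ i, L.Relations i)]
  [L.IsOrdered]

/-- Letters of the atomic formula `&i₁ < &i₂` at depth `k`. [folklore] -/
theorem formulaLetters_lt_var {k : ℕ} (i₁ i₂ : Fin k) :
    formulaLetters ((var (Sum.inr i₁)).lt (var (Sum.inr i₂)) : L.BoundedFormula Empty k) =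
      ltLetters (encode (⟨2, leSymb⟩ : Σ n, L.Relations n)) k i₁ i₂ := by
  rw [Term.lt, formulaLetters_inf, formulaLetters_not, formulaLetters_le_var, formulaLetters_le_var]
  rfl

omit [L.IsOrdered] in
/-- The letters of `cov φ`. [folklore] -/
theorem formulaLetters_cov {m : ℕ} (φ : L.BoundedFormula Empty (m + 2)) :
    formulaLetters (cov φ) = covLetters m (formulaLetters φ) := by
  rw [cov, formulaLetters_all, formulaLetters_ex]
  rfl

/-- The letters of `inc φ`. [folklore] -/
theorem formulaLetters_inc {m : ℕ} (φ : L.BoundedFormula Empty (m + 2)) :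
    formulaLetters (inc φ) =
      incLetters (encode (⟨2, leSymb⟩ : Σ n, L.Relations n)) m (formulaLetters φ) := by
  rw [inc, formulaLetters_all, formulaLetters_all, formulaLetters_all, formulaLetters_imp,
    formulaLetters_le_var, formulaLetters_imp, formulaLetters_liftAt, formulaLetters_liftAt]
  rfl

/-- The letters of `clAnte m`. [folklore] -/
theorem formulaLetters_clAnte (m : ℕ) :
    formulaLetters (clAnte m : L.BoundedFormula Empty (m + 4)) =
      clAnteLetters (encode (⟨2, leSymb⟩ : Σ n, L.Relations n)) m := by
  rw [clAnte, formulaLetters_inf, formulaLetters_lt_var, formulaLetters_lt_var]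
  rfl

/-- The letters of `clBody ψ`. [folklore] -/
theorem formulaLetters_clBody {m : ℕ} (ψ : L.BoundedFormula Empty (m + 2)) :
    formulaLetters (clBody ψ) =
      clBodyLetters (encode (⟨2, leSymb⟩ : Σ n, L.Relations n)) m (formulaLetters ψ) := by
  rw [clBody, lift3, formulaLetters_inf, formulaLetters_inf, formulaLetters_lt_var,
    formulaLetters_lt_var, formulaLetters_liftAt, formulaLetters_liftAt, formulaLetters_liftAt]
  rfl

/-- The letters of `cl ψ`. [folklore] -/
theorem formulaLetters_cl {m : ℕ} (ψ : L.BoundedFormula Empty (m + 2)) :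
    formulaLetters (cl ψ) =
      clLetters (encode (⟨2, leSymb⟩ : Σ n, L.Relations n)) m (formulaLetters ψ) := by
  rw [cl, formulaLetters_all, formulaLetters_all, formulaLetters_imp, formulaLetters_clAnte,
    formulaLetters_ex, formulaLetters_clBody]
  rfl

/-- The letters of `ndAnte m`. [folklore] -/
theorem formulaLetters_ndAnte (m : ℕ) :
    formulaLetters (ndAnte m : L.BoundedFormula Empty (m + 3)) =
      ndAnteLetters (encode (⟨2, leSymb⟩ : Σ n, L.Relations n)) m := by
  rw [ndAnte, formulaLetters_lt_var]
  rfl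

/-- The letters of `ndBody ψ`. [folklore] -/
theorem formulaLetters_ndBody {m : ℕ} (ψ : L.BoundedFormula Empty (m + 2)) :
    formulaLetters (ndBody ψ) =
      ndBodyLetters (encode (⟨2, leSymb⟩ : Σ n, L.Relations n)) m (formulaLetters ψ) := by
  rw [ndBody, lift2, formulaLetters_inf, formulaLetters_inf, formulaLetters_lt_var,
    formulaLetters_lt_var, formulaLetters_not, formulaLetters_liftAt, formulaLetters_liftAt,
    formulaLetters_cl]
  rfl

/-- The letters of `nd ψ`. [folklore] -/
theorem formulaLetters_nd {m : ℕ} (ψ : L.BoundedFormula Empty (m + 2)) :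
    formulaLetters (nd ψ) =
      ndLetters (encode (⟨2, leSymb⟩ : Σ n, L.Relations n)) m (formulaLetters ψ) := by
  rw [nd, formulaLetters_all, formulaLetters_all, formulaLetters_all, formulaLetters_imp,
    formulaLetters_ndAnte, formulaLetters_ex, formulaLetters_ndBody]
  rfl

/-- **The letters of the instance `sentence φ` of the Baire scheme** are
`baireLetters rLe m (formulaLetters φ)`. [folklore] -/
theorem formulaLetters_sentence {m : ℕ} (φ : L.BoundedFormula Empty (m + 2)) :
    formulaLetters (sentence φ) =
      baireLetters (encode (⟨2, leSymb⟩ : Σ n, L.Relations n)) m (formulaLetters φ) := by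
  rw [sentence, formulaLetters_alls, formulaLetters_imp, formulaLetters_imp, formulaLetters_not,
    formulaLetters_cov, formulaLetters_inc, formulaLetters_nd,
    formulaLetters_swapAt (by omega : m + 1 < m + 2)]
  rfl

end SchemeLetters

/-! ### The recogniser of the letter strings of the scheme -/

/-- After the `m` leading `7`s and the five letters `3, 7, 3, 7, 3`, the letters of
`sentence φ` continue with the letters of `φ`. [folklore] -/
theorem drop_baireLetters (rLe m : ℕ) (w : List ℕ) :
    (baireLetters rLe m w).drop (m + 5) =
      w ++ ([4 * (m + 2) + 11, 4 * (m + 1) + 11] ++ 3 :: (incLetters rLe m w ++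
        notLetters m (ndLetters rLe m (w.map (swapLetter m))))) := by
  rw [baireLetters, ← List.drop_drop, List.drop_left' (List.length_replicate)]
  simp [covLetters, exLetters]

/-- One candidate `m`: the letters after position `m + 5` begin with the letters `w` of a
formula at depth `m + 2` (found by `parseF`, which returns the unread remainder) and `l` is
exactly `baireLetters rLe m w`. [folklore] -/
def baireLettersStep (oF oR : ℕ → Option ℕ) (rLe m : ℕ) (l : List ℕ) : Bool :=
  ((parseF oF oR l.length (m + 2) (l.drop (m + 5))).map fun rest =>
    decide (l = baireLetters rLe m
      ((l.drop (m + 5)).take ((l.drop (m + 5)).length - rest.length)))).getD false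

/-- The recogniser of the letter strings of the instances of the Baire scheme, relative to arity
oracles and the code `rLe` of `≤`: some `m ≤ |l|` works. [folklore] -/
def baireLettersB (oF oR : ℕ → Option ℕ) (rLe : ℕ) (l : List ℕ) : Bool :=
  decide (∃ m < l.length + 1, baireLettersStep oF oR rLe m l = true)

section Correct

variable {L : Language} [Encodable (Σ i, L.Functions i)] [Encodable (Σ i, L.Relations i)]
  [L.IsOrdered]

/-- **Correctness of the recogniser**: it accepts exactly the letter strings of the instances
`sentence φ` of the Baire scheme. [folklore] -/
theorem baireLettersB_iff {l : List ℕ} :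
    baireLettersB (arityF L) (arityR L) (encode (⟨2, leSymb⟩ : Σ n, L.Relations n)) l = true ↔
      ∃ (m : ℕ) (φ : L.BoundedFormula Empty (m + 2)), formulaLetters (sentence φ) = l := by
  rw [baireLettersB, decide_eq_true_eq]
  constructor
  · rintro ⟨m, -, hm⟩
    rw [baireLettersStep] at hm
    cases hp : parseF (arityF L) (arityR L) l.length (m + 2) (l.drop (m + 5)) with
    | none => rw [hp] at hm; simp at hm
    | some rest =>
      rw [hp, Option.map_some, Option.getD_some, decide_eq_true_eq] at hm
      obtain ⟨φ, hφ⟩ := exists_boundedFormula_of_parseF _ _ _ _ hp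
      refine ⟨m, φ, ?_⟩
      rw [formulaLetters_sentence, hm, hφ, List.length_append, Nat.add_sub_cancel, List.take_left']
      rfl
  · rintro ⟨m, φ, rfl⟩
    have hlen : m + (formulaLetters φ).length < (formulaLetters (sentence φ)).length := by
      rw [formulaLetters_sentence]
      simp [baireLetters, covLetters, exLetters]
      omega
    refine ⟨m, by omega, ?_⟩
    rw [baireLettersStep, formulaLetters_sentence, drop_baireLetters,
      parseF_formulaLetters φ _ _ (by rw [← formulaLetters_sentence]; omega), Option.map_some,
      Option.getD_some, decide_eq_true_eq, List.length_append, Nat.add_sub_cancel, List.take_left']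
    rfl

end Correct

/-! ### The letter builders are primitive recursive -/

section PrimrecLetters

open Primrec

/-- `swapVar` is primitive recursive in `(m, x)`. [folklore] -/
theorem primrec_swapVar : Primrec fun q : ℕ × ℕ => swapVar q.1 q.2 := by
  have hx : Primrec fun q : ℕ × ℕ => q.2 := snd
  have hm : Primrec fun q : ℕ × ℕ => q.1 := fst
  unfold swapVar
  refine ite (PrimrecPred.and (PrimrecRel.comp Primrec.eq (nat_mod.comp hx (const 4)) (const 2))
    (PrimrecRel.comp Primrec.eq (nat_div.comp hx (const 4)) hm)) (nat_add.comp hx (const 4)) ?_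
  exact ite (PrimrecPred.and (PrimrecRel.comp Primrec.eq (nat_mod.comp hx (const 4)) (const 2))
    (PrimrecRel.comp Primrec.eq (nat_div.comp hx (const 4)) (nat_add.comp hm (const 1))))
    (nat_sub.comp hx (const 4)) hx

/-- `swapTermCode` is primitive recursive in `(m, c)`. [folklore] -/
theorem primrec_swapTermCode : Primrec fun q : ℕ × ℕ => swapTermCode q.1 q.2 := by
  unfold swapTermCode
  refine Primrec.encode.comp (list_map ((Primrec.ofNat (List ℕ)).comp snd) ?_)
  exact (primrec_swapVar.comp (Primrec.pair (fst.comp fst) snd)).to₂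

/-- `swapLetter` is primitive recursive in `(m, x)`. [folklore] -/
theorem primrec_swapLetter : Primrec fun q : ℕ × ℕ => swapLetter q.1 q.2 := by
  have hx : Primrec fun q : ℕ × ℕ => q.2 := snd
  have hm : Primrec fun q : ℕ × ℕ => q.1 := fst
  have hu : Primrec fun q : ℕ × ℕ => (q.2 / 2).unpair := unpair.comp (nat_div.comp hx (const 2))
  unfold swapLetter
  refine ite (PrimrecRel.comp Primrec.eq (nat_mod.comp hx (const 2)) (const 0)) ?_ hx
  exact nat_mul.comp (const 2) (Primrec₂.natPair.comp (fst.comp hu)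
    (primrec_swapTermCode.comp (Primrec.pair hm (snd.comp hu))))

/-- `w.map (swapLetter m)` is primitive recursive in `(m, w)`. [folklore] -/
theorem primrec_map_swapLetter : Primrec fun q : ℕ × List ℕ => q.2.map (swapLetter q.1) :=
  list_map snd (primrec_swapLetter.comp (Primrec.pair (fst.comp fst) snd)).to₂

/-- `notLetters` is primitive recursive in `(k, w)`. [folklore] -/
theorem primrec_notLetters : Primrec fun q : ℕ × List ℕ => notLetters q.1 q.2 := by
  unfold notLetters
  exact list_cons.comp (const 3) (list_append.comp snd (list_cons.comp
    (nat_add.comp (nat_mul.comp (const 4) fst) (const 11)) (const [])))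

/-- `infLetters` is primitive recursive in `(k, w₁, w₂)`. [folklore] -/
theorem primrec_infLetters : Primrec fun q : ℕ × List ℕ × List ℕ => infLetters q.1 q.2.1 q.2.2 := by
  unfold infLetters
  have hb : Primrec fun q : ℕ × List ℕ × List ℕ => [4 * q.1 + 11] :=
    list_cons.comp (nat_add.comp (nat_mul.comp (const 4) fst) (const 11)) (const [])
  exact list_cons.comp (const 3) (list_append.comp (list_cons.comp (const 3)
    (list_append.comp (fst.comp snd) (list_cons.comp (const 3)
      (list_append.comp (snd.comp snd) hb)))) hb)

/-- `ltLetters` is primitive recursive in `(rLe, k, i₁, i₂)`. [folklore] -/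
theorem primrec_ltLetters : Primrec fun q : ℕ × ℕ × ℕ × ℕ => ltLetters q.1 q.2.1 q.2.2.1 q.2.2.2 := by
  unfold ltLetters
  have hk : Primrec fun q : ℕ × ℕ × ℕ × ℕ => q.2.1 := fst.comp snd
  have h12 := primrec_leLetters
  have h21 : Primrec fun q : ℕ × ℕ × ℕ × ℕ => leLetters q.1 q.2.1 q.2.2.2 q.2.2.1 :=
    primrec_leLetters.comp (Primrec.pair fst (Primrec.pair hk
      (Primrec.pair (snd.comp (snd.comp snd)) (fst.comp (snd.comp snd)))))
  exact primrec_infLetters.comp (Primrec.pair hk (Primrec.pair h12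
    (primrec_notLetters.comp (Primrec.pair hk h21))))

/-- `ltLetters rLe (m + a) (m + b) (m + c)` is primitive recursive in `(rLe, m)`. [folklore] -/
theorem primrec_ltLetters_shift (a b c : ℕ) :
    Primrec fun q : ℕ × ℕ => ltLetters q.1 (q.2 + a) (q.2 + b) (q.2 + c) :=
  primrec_ltLetters.comp (Primrec.pair fst (Primrec.pair (nat_add.comp snd (const a))
    (Primrec.pair (nat_add.comp snd (const b)) (nat_add.comp snd (const c)))))

/-- `covLetters` is primitive recursive in `(m, w)`. [folklore] -/
theorem primrec_covLetters : Primrec fun q : ℕ × List ℕ => covLetters q.1 q.2 := by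
  unfold covLetters
  exact list_cons.comp (const 7) (primrec_exLetters.comp (Primrec.pair (nat_add.comp fst (const 1)) snd))

/-- `incLetters` is primitive recursive in `(rLe, m, w)`. [folklore] -/
theorem primrec_incLetters : Primrec fun q : ℕ × ℕ × List ℕ => incLetters q.1 q.2.1 q.2.2 := by
  unfold incLetters
  have hm : Primrec fun q : ℕ × ℕ × List ℕ => q.2.1 := fst.comp snd
  have hw : Primrec fun q : ℕ × ℕ × List ℕ => q.2.2 := snd.comp snd
  have hle : Primrec fun q : ℕ × ℕ × List ℕ => leLetters q.1 (q.2.1 + 3) (q.2.1 + 1) (q.2.1 + 2) :=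
    primrec_leLetters.comp (Primrec.pair fst (Primrec.pair (nat_add.comp hm (const 3))
      (Primrec.pair (nat_add.comp hm (const 1)) (nat_add.comp hm (const 2)))))
  have hl2 : Primrec fun q : ℕ × ℕ × List ℕ => liftLetters 1 (q.2.1 + 2) q.2.2 :=
    primrec_liftLetters.comp (Primrec.pair (Primrec.pair (const 1) (nat_add.comp hm (const 2))) hw)
  have hl1 : Primrec fun q : ℕ × ℕ × List ℕ => liftLetters 1 (q.2.1 + 1) q.2.2 :=
    primrec_liftLetters.comp (Primrec.pair (Primrec.pair (const 1) (nat_add.comp hm (const 1))) hw)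
  exact list_cons.comp (const 7) (list_cons.comp (const 7) (list_cons.comp (const 7)
    (list_cons.comp (const 3) (list_append.comp hle (list_cons.comp (const 3)
      (list_append.comp hl2 hl1))))))

/-- `clAnteLetters` is primitive recursive in `(rLe, m)`. [folklore] -/
theorem primrec_clAnteLetters : Primrec fun q : ℕ × ℕ => clAnteLetters q.1 q.2 := by
  unfold clAnteLetters
  exact primrec_infLetters.comp (Primrec.pair (nat_add.comp snd (const 4))
    (Primrec.pair (primrec_ltLetters_shift 4 2 1) (primrec_ltLetters_shift 4 1 3)))

/-- `liftLetters 1 (m + 1) w` is primitive recursive in `(m, w)`. [folklore] -/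
theorem primrec_liftLetters_one_succ : Primrec fun q : ℕ × List ℕ => liftLetters 1 (q.1 + 1) q.2 :=
  primrec_liftLetters.comp (Primrec.pair (Primrec.pair (const 1) (nat_add.comp fst (const 1))) snd)

/-- `lift3Letters` is primitive recursive in `(m, w)`. [folklore] -/
theorem primrec_lift3Letters : Primrec fun q : ℕ × List ℕ => lift3Letters q.1 q.2 := by
  unfold lift3Letters
  have h1 := primrec_liftLetters_one_succ
  have h2 : Primrec fun q : ℕ × List ℕ => liftLetters 1 (q.1 + 1) (liftLetters 1 (q.1 + 1) q.2) :=
    primrec_liftLetters_one_succ.comp (Primrec.pair fst h1)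
  exact primrec_liftLetters_one_succ.comp (Primrec.pair fst h2)

/-- `lift2Letters` is primitive recursive in `(m, w)`. [folklore] -/
theorem primrec_lift2Letters : Primrec fun q : ℕ × List ℕ => lift2Letters q.1 q.2 := by
  unfold lift2Letters
  exact primrec_liftLetters_one_succ.comp (Primrec.pair fst primrec_liftLetters_one_succ)

/-- `clBodyLetters` is primitive recursive in `(rLe, m, w)`. [folklore] -/
theorem primrec_clBodyLetters : Primrec fun q : ℕ × ℕ × List ℕ => clBodyLetters q.1 q.2.1 q.2.2 := by
  unfold clBodyLetters
  have hm : Primrec fun q : ℕ × ℕ × List ℕ => q.2.1 := fst.comp snd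
  have hrm : Primrec fun q : ℕ × ℕ × List ℕ => (q.1, q.2.1) := Primrec.pair fst hm
  have h5 : Primrec fun q : ℕ × ℕ × List ℕ => q.2.1 + 5 := nat_add.comp hm (const 5)
  have hinner : Primrec fun q : ℕ × ℕ × List ℕ => infLetters (q.2.1 + 5)
      (ltLetters q.1 (q.2.1 + 5) (q.2.1 + 2) (q.2.1 + 4)) (ltLetters q.1 (q.2.1 + 5) (q.2.1 + 4) (q.2.1 + 3)) :=
    primrec_infLetters.comp (Primrec.pair h5 (Primrec.pair ((primrec_ltLetters_shift 5 2 4).comp hrm)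
      ((primrec_ltLetters_shift 5 4 3).comp hrm)))
  exact primrec_infLetters.comp (Primrec.pair h5 (Primrec.pair hinner
    (primrec_lift3Letters.comp snd)))

/-- `clLetters` is primitive recursive in `(rLe, m, w)`. [folklore] -/
theorem primrec_clLetters : Primrec fun q : ℕ × ℕ × List ℕ => clLetters q.1 q.2.1 q.2.2 := by
  unfold clLetters
  have hm : Primrec fun q : ℕ × ℕ × List ℕ => q.2.1 := fst.comp snd
  have hante : Primrec fun q : ℕ × ℕ × List ℕ => clAnteLetters q.1 q.2.1 :=
    primrec_clAnteLetters.comp (Primrec.pair fst hm)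
  have hex : Primrec fun q : ℕ × ℕ × List ℕ => exLetters (q.2.1 + 4) (clBodyLetters q.1 q.2.1 q.2.2) :=
    primrec_exLetters.comp (Primrec.pair (nat_add.comp hm (const 4)) primrec_clBodyLetters)
  exact list_cons.comp (const 7) (list_cons.comp (const 7) (list_cons.comp (const 3)
    (list_append.comp hante hex)))

/-- `ndBodyLetters` is primitive recursive in `(rLe, m, w)`. [folklore] -/
theorem primrec_ndBodyLetters : Primrec fun q : ℕ × ℕ × List ℕ => ndBodyLetters q.1 q.2.1 q.2.2 := by
  unfold ndBodyLetters
  have hm : Primrec fun q : ℕ × ℕ × List ℕ => q.2.1 := fst.comp snd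
  have hrm : Primrec fun q : ℕ × ℕ × List ℕ => (q.1, q.2.1) := Primrec.pair fst hm
  have h4 : Primrec fun q : ℕ × ℕ × List ℕ => q.2.1 + 4 := nat_add.comp hm (const 4)
  have hinner : Primrec fun q : ℕ × ℕ × List ℕ => infLetters (q.2.1 + 4)
      (ltLetters q.1 (q.2.1 + 4) (q.2.1 + 1) (q.2.1 + 3)) (ltLetters q.1 (q.2.1 + 4) (q.2.1 + 3) (q.2.1 + 2)) :=
    primrec_infLetters.comp (Primrec.pair h4 (Primrec.pair ((primrec_ltLetters_shift 4 1 3).comp hrm)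
      ((primrec_ltLetters_shift 4 3 2).comp hrm)))
  have hnot : Primrec fun q : ℕ × ℕ × List ℕ =>
      notLetters (q.2.1 + 4) (lift2Letters q.2.1 (clLetters q.1 q.2.1 q.2.2)) :=
    primrec_notLetters.comp (Primrec.pair h4 (primrec_lift2Letters.comp (Primrec.pair hm primrec_clLetters)))
  exact primrec_infLetters.comp (Primrec.pair h4 (Primrec.pair hinner hnot))

/-- `ndLetters` is primitive recursive in `(rLe, m, w)`. [folklore] -/
theorem primrec_ndLetters : Primrec fun q : ℕ × ℕ × List ℕ => ndLetters q.1 q.2.1 q.2.2 := by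
  unfold ndLetters ndAnteLetters
  have hm : Primrec fun q : ℕ × ℕ × List ℕ => q.2.1 := fst.comp snd
  have hante : Primrec fun q : ℕ × ℕ × List ℕ => ltLetters q.1 (q.2.1 + 3) (q.2.1 + 1) (q.2.1 + 2) :=
    (primrec_ltLetters_shift 3 1 2).comp (Primrec.pair fst hm)
  have hex : Primrec fun q : ℕ × ℕ × List ℕ => exLetters (q.2.1 + 3) (ndBodyLetters q.1 q.2.1 q.2.2) :=
    primrec_exLetters.comp (Primrec.pair (nat_add.comp hm (const 3)) primrec_ndBodyLetters)
  exact list_cons.comp (const 7) (list_cons.comp (const 7) (list_cons.comp (const 7)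
    (list_cons.comp (const 3) (list_append.comp hante hex))))

/-- `baireLetters` is primitive recursive in `(rLe, m, w)`. [folklore] -/
theorem primrec_baireLetters : Primrec fun q : ℕ × ℕ × List ℕ => baireLetters q.1 q.2.1 q.2.2 := by
  unfold baireLetters
  have hm : Primrec fun q : ℕ × ℕ × List ℕ => q.2.1 := fst.comp snd
  have hw : Primrec fun q : ℕ × ℕ × List ℕ => q.2.2 := snd.comp snd
  have hrep : Primrec fun q : ℕ × ℕ × List ℕ => List.replicate q.2.1 7 :=
    (list_map (list_range.comp hm) (const 7).to₂).of_eq fun q => by simp [List.map_const']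
  have hcov : Primrec fun q : ℕ × ℕ × List ℕ => covLetters q.2.1 q.2.2 := primrec_covLetters.comp snd
  have hsw : Primrec fun q : ℕ × ℕ × List ℕ => q.2.2.map (swapLetter q.2.1) :=
    primrec_map_swapLetter.comp snd
  have hnd : Primrec fun q : ℕ × ℕ × List ℕ =>
      notLetters q.2.1 (ndLetters q.1 q.2.1 (q.2.2.map (swapLetter q.2.1))) :=
    primrec_notLetters.comp (Primrec.pair hm (primrec_ndLetters.comp
      (Primrec.pair fst (Primrec.pair hm hsw))))
  exact list_append.comp hrep (list_cons.comp (const 3) (list_append.comp hcov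
    (list_cons.comp (const 3) (list_append.comp primrec_incLetters hnd))))

/-- Arguments of the table-relative recogniser: `(τF, τR, rLe, m, letters)`. [folklore] -/
abbrev BArg : Type := List (Option ℕ) × List (Option ℕ) × ℕ × ℕ × List ℕ

/-- The table-relative step as a unary function. [folklore] -/
def bStep (b : BArg) : Bool := baireLettersStep (tab b.1) (tab b.2.1) b.2.2.1 b.2.2.2.1 b.2.2.2.2

/-- `bStep` is primitive recursive (through `primrec_pF` of `SentenceCodes.lean`). [folklore] -/
theorem primrec_bStep : Primrec bStep := by
  have hτF : Primrec fun b : BArg => b.1 := fst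
  have hτR : Primrec fun b : BArg => b.2.1 := fst.comp snd
  have hr : Primrec fun b : BArg => b.2.2.1 := fst.comp (snd.comp snd)
  have hm : Primrec fun b : BArg => b.2.2.2.1 := fst.comp (snd.comp (snd.comp snd))
  have hl : Primrec fun b : BArg => b.2.2.2.2 := snd.comp (snd.comp (snd.comp snd))
  have hd : Primrec fun b : BArg => b.2.2.2.2.drop (b.2.2.2.1 + 5) :=
    list_drop.comp (nat_add.comp hm (const 5)) hl
  have hparse : Primrec fun b : BArg =>
      parseF (tab b.1) (tab b.2.1) b.2.2.2.2.length (b.2.2.2.1 + 2) (b.2.2.2.2.drop (b.2.2.2.1 + 5)) :=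
    primrec_pF.comp (Primrec.pair hτF (Primrec.pair hτR (Primrec.pair (list_length.comp hl)
      (Primrec.pair (nat_add.comp hm (const 2)) hd))))
  have hw : Primrec fun q : BArg × List ℕ =>
      (q.1.2.2.2.2.drop (q.1.2.2.2.1 + 5)).take ((q.1.2.2.2.2.drop (q.1.2.2.2.1 + 5)).length - q.2.length) :=
    list_take.comp (nat_sub.comp (list_length.comp (hd.comp fst)) (list_length.comp snd)) (hd.comp fst)
  have hdc : Primrec fun q : BArg × List ℕ => baireLetters q.1.2.2.1 q.1.2.2.2.1
      ((q.1.2.2.2.2.drop (q.1.2.2.2.1 + 5)).take ((q.1.2.2.2.2.drop (q.1.2.2.2.1 + 5)).length - q.2.length)) :=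
    primrec_baireLetters.comp (Primrec.pair (hr.comp fst) (Primrec.pair (hm.comp fst) hw))
  have hpred : PrimrecPred fun q : BArg × List ℕ => q.1.2.2.2.2 = baireLetters q.1.2.2.1 q.1.2.2.2.1
      ((q.1.2.2.2.2.drop (q.1.2.2.2.1 + 5)).take ((q.1.2.2.2.2.drop (q.1.2.2.2.1 + 5)).length - q.2.length)) :=
    PrimrecRel.comp (Primrec.eq (α := List ℕ)) (hl.comp fst) hdc
  have hbody : Primrec fun q : BArg × List ℕ =>
      decide (q.1.2.2.2.2 = baireLetters q.1.2.2.1 q.1.2.2.2.1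
        ((q.1.2.2.2.2.drop (q.1.2.2.2.1 + 5)).take
          ((q.1.2.2.2.2.drop (q.1.2.2.2.1 + 5)).length - q.2.length))) := hpred.decide
  exact ((option_getD.comp (option_map hparse hbody.to₂) (const false)).of_eq fun b => rfl)

/-- The table-relative recogniser is primitive recursive in `(τF, τR, rLe, letters)`. [folklore] -/
theorem primrec_baireLettersB :
    Primrec fun q : List (Option ℕ) × List (Option ℕ) × ℕ × List ℕ =>
      baireLettersB (tab q.1) (tab q.2.1) q.2.2.1 q.2.2.2 := by
  have hR : PrimrecRel fun (m : ℕ) (q : List (Option ℕ) × List (Option ℕ) × ℕ × List ℕ) =>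
      bStep (q.1, q.2.1, q.2.2.1, m, q.2.2.2) = true :=
    PrimrecRel.comp Primrec.eq (primrec_bStep.comp (Primrec.pair (fst.comp snd) (Primrec.pair
      (fst.comp (snd.comp snd)) (Primrec.pair (fst.comp (snd.comp (snd.comp snd))) (Primrec.pair fst
        (snd.comp (snd.comp (snd.comp snd)))))))) (const true)
  have h := (PrimrecRel.exists_mem_list hR).comp
    (list_range.comp (succ.comp (list_length.comp (snd.comp (snd.comp
      (snd (α := List (Option ℕ)) (β := List (Option ℕ) × ℕ × List ℕ)))))))
    (Primrec.id (α := List (Option ℕ) × List (Option ℕ) × ℕ × List ℕ))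
  refine (PrimrecPred.decide h).of_eq fun q => ?_
  rw [baireLettersB]
  refine decide_eq_decide.2 ?_
  simp [List.mem_range, bStep]

end PrimrecLetters

section Congr

variable {oF oF' oR oR' : ℕ → Option ℕ} {B : ℕ}

/-- The step only consults the oracles below the letters. [folklore] -/
theorem baireLettersStep_congr (hoF : ∀ i < B, oF i = oF' i) (hoR : ∀ i < B, oR i = oR' i)
    (rLe m : ℕ) {l : List ℕ} (hl : ∀ x ∈ l, x < B) :
    baireLettersStep oF oR rLe m l = baireLettersStep oF' oR' rLe m l := by
  unfold baireLettersStep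
  rw [parseF_congr hoF hoR _ _ _ fun x hx => hl x (List.drop_subset _ _ hx)]

/-- The recogniser only consults the oracles below the letters. [folklore] -/
theorem baireLettersB_congr (hoF : ∀ i < B, oF i = oF' i) (hoR : ∀ i < B, oR i = oR' i)
    (rLe : ℕ) {l : List ℕ} (hl : ∀ x ∈ l, x < B) :
    baireLettersB oF oR rLe l = baireLettersB oF' oR' rLe l := by
  unfold baireLettersB
  simp only [baireLettersStep_congr hoF hoR rLe _ hl]

end Congr

section Decide

variable {L : Language} [Encodable (Σ i, L.Functions i)] [Encodable (Σ i, L.Relations i)]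

omit [Encodable (Σ i, L.Functions i)] [Encodable (Σ i, L.Relations i)] in
/-- **The recogniser with computable oracles is computable** (the oracles are tabulated below
the input, which bounds every symbol consulted). [folklore] -/
theorem computable_baireLettersB {arF arR : ℕ → Option ℕ} (hF : Computable arF)
    (hR : Computable arR) (rLe : ℕ) :
    Computable fun n : ℕ => baireLettersB arF arR rLe (ofNat (List ℕ) n) := by
  have h1 : Computable fun n : ℕ => baireLettersB (tab (arityTable arF (n + 1)))
      (tab (arityTable arR (n + 1))) rLe (ofNat (List ℕ) n) :=
    primrec_baireLettersB.to_comp.comp (((computable_arityTable hF).comp Computable.succ).pair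
      (((computable_arityTable hR).comp Computable.succ).pair ((Computable.const rLe).pair
        (Computable.ofNat _))))
  refine h1.of_eq fun n => ?_
  exact baireLettersB_congr (B := n + 1) (fun i hi => tab_arityTable_of_lt hi)
    (fun i hi => tab_arityTable_of_lt hi) rLe (fun x hx => Nat.lt_succ_of_lt (lt_of_mem_ofNat hx))

variable [L.IsOrdered]

/-- **The set of Gödel numbers of the instances of the Baire scheme is decidable**, for a
language whose arity tables are computable. [cite: FornasieroServi2010, Remark 2.10] -/
theorem computablePred_exists_sentence_godelNumber_eq (hF : Computable (arityF L))
    (hR : Computable (arityR L)) :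
    ComputablePred fun n : ℕ =>
      ∃ (m : ℕ) (φ : L.BoundedFormula Empty (m + 2)), (sentence φ).godelNumber = n := by
  refine ComputablePred.computable_iff.2 ⟨_, computable_baireLettersB hF hR
    (encode (⟨2, leSymb⟩ : Σ n, L.Relations n)), funext fun n => propext ?_⟩
  rw [baireLettersB_iff]
  constructor
  · rintro ⟨m, φ, h⟩
    exact ⟨m, φ, by rw [← h, godelNumber_eq, ofNat_encode]⟩
  · rintro ⟨m, φ, h⟩
    exact ⟨m, φ, by rw [godelNumber_eq, h, encode_ofNat]⟩

/-- **The Baire scheme `DefinableBaire.scheme L` is a recursive set of sentences** for every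
language with computable arity tables (Fornasiero–Servi 2010, Remark 2.10).  (This is the Baire
half of `[DCB]`; the parallel statement for the definable completeness scheme
`DefinableCompleteness.scheme L` is `DefinableCompleteness.isRecursive_scheme` — same shape,
different scheme.) [cite: FornasieroServi2010, Remark 2.10] -/
theorem isRecursive_scheme (hF : Computable (arityF L)) (hR : Computable (arityR L)) :
    (scheme L).IsRecursive := by
  have h := computablePred_exists_sentence_godelNumber_eq hF hR
  unfold Theory.IsRecursive
  convert h using 2 with n
  simp only [scheme, Set.mem_setOf_eq]
  constructor
  · rintro ⟨σ, ⟨m, φ, rfl⟩, hσ⟩; exact ⟨m, φ, hσ⟩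
  · rintro ⟨m, φ, h⟩; exact ⟨_, ⟨m, φ, rfl⟩, h⟩

/-- The Baire scheme `DefinableBaire.scheme L` is recursive for every recursively presented
ordered language (parallel to `DefinableCompleteness.isRecursive_scheme_of_isRecursivelyPresented`
for `[DC]`). [cite: FornasieroServi2010, Remark 2.10] -/
theorem isRecursive_scheme_of_isRecursivelyPresented (hL : L.IsRecursivelyPresented) :
    (scheme L).IsRecursive :=
  isRecursive_scheme hL.computable_arityF hL.computable_arityR

end Decide

/-- **The Baire scheme `DefinableBaire.scheme` in the language `(+, *, -, 0, 1, exp, ≤)` of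
`ℝ_exp` is a recursive set of sentences** (parallel to
`DefinableCompleteness.isRecursive_scheme_orderedExpRing` for `[DC]`). [cite: FornasieroServi2010, Remark 2.10] -/
theorem isRecursive_scheme_orderedExpRing : (scheme Language.orderedExpRing).IsRecursive :=
  isRecursive_scheme_of_isRecursivelyPresented Language.orderedExpRing.isRecursivelyPresented

/-- The Baire scheme `DefinableBaire.scheme` in the language of ordered rings is a recursive set
of sentences (parallel to `DefinableCompleteness.isRecursive_scheme_orderedRing` for `[DC]`).
[cite: FornasieroServi2010, Remark 2.10] -/
theorem isRecursive_scheme_orderedRing : (scheme Language.orderedRing).IsRecursive :=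
  isRecursive_scheme_of_isRecursivelyPresented Language.orderedRing.isRecursivelyPresented

end DefinableBaire

end Literature.ModelTheory.ExponentialFields
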